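import Mathlib.Data.Nat.Digits.Lemmas
import Mathlib.Data.List.GetD
import Mathlib.Algebra.Order.BigOperators.Group.Finset
import Mathlib.Algebra.BigOperators.Ring.Finset
import Mathlib.Tactic
import HarnessLib

/-!
# Kronecker substitution: a dot product of natural-number vectors as ONE big multiplication (kernel certificates)

Topic `Literature/Analysis/ValidatedNumerics` (kernel-decidable numerics).  Lean's kernel evaluates `Nat` arithmetic on
literals with GMP, but every structural step of a list recursion costs a fixed interpretive overhead; a dot product
`Σ_k a_k b_k` of length `n` evaluated by recursion costs `n` such multiply–add steps, while the classical KRONECKER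
SUBSTITUTION [cite: GathenGerhard2013ModernComputerAlgebra, §8.4] — pack `a` as the natural number `A = Σ_k a_k W^k`, pack
`b` reversed as `B = Σ_k b_k W^{n−1−k}`, and read the dot product off as the base-`W` digit of `A·B` at position `n − 1` —
costs ONE multiplication, one division and one remainder, independently of `n`; the packing is paid once per vector, not
once per pair of vectors.  Measured on the gate farm (PSD certificates of format C, `n = 100…150` rows): `≈ 6×` less
kernel time at `n = 100` and a single declaration where the structural `O(n³)` check exceeds the per-declaration memory
cap at `n = 150`.  Signed vectors are handled by the consumer with offset digits `a_k + M` (all arithmetic stays in `ℕ`;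
the kernel's `Int` multiplication of mixed-sign big values is slow).

* `packN W a = Σ_k a_k W^k`, `packRevN W n b = Σ_k b_k W^(n−1−k)`, `sumN` (Horner / structural recursions);
* `kdotN W n A B = A·B / W^(n−1) % W`;
* **`kdotN_packN_packRevN`** — for `a`, `b : List ℕ` of lengths `≤ n`, `1 ≤ n`, entries `≤ Ma`, `≤ Mb` and
  `n·Ma·Mb < W`:  `kdotN W n (packN W a) (packRevN W n b) = Σ_{k<n} a_k b_k` (`getD`-padded);
* bookkeeping lemmas `packN_eq_sum`, `packRevN_eq_sum`, `sumN_eq_sum`, `sum_div_pow_mod` (base-`W` digit extraction).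

Elementary and fully proved; the content is the SHAPE of the computation the kernel performs.
-/

open Finset
open scoped BigOperators

namespace Literature.Analysis.ValidatedNumerics

namespace KroneckerDot

/-! ## The kernel-side functions -/

/-- `packN W [a₀, a₁, …] = Σ_k a_k W^k` (Horner). [cite: GathenGerhard2013ModernComputerAlgebra, §8.4] -/
def packN (W : ℕ) : List ℕ → ℕ
  | [] => 0
  | a :: as => a + W * packN W as

/-- `packRevN W n [b₀, b₁, …] = Σ_k b_k W^(n−1−k)` (the partner polynomial, reversed inside degree `n − 1`).
[cite: GathenGerhard2013ModernComputerAlgebra, §8.4] -/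
def packRevN (W : ℕ) : ℕ → List ℕ → ℕ
  | _, [] => 0
  | n, b :: bs => b * W ^ (n - 1) + packRevN W (n - 1) bs

/-- Sum of a list of naturals (structural; plumbing for offset bookkeeping). [folklore] -/
def sumN : List ℕ → ℕ
  | [] => 0
  | a :: as => a + sumN as

/-- **The Kronecker dot product**: the base-`W` digit of `A·B` at position `n − 1`.
[cite: GathenGerhard2013ModernComputerAlgebra, §8.4] -/
def kdotN (W n A B : ℕ) : ℕ := A * B / W ^ (n - 1) % W

/-! ## Semantics of the recursions -/

/-- `packN` is evaluation of the coefficient list at `W`: `Σ_i a_i W^i`. [cite: GathenGerhard2013ModernComputerAlgebra, §8.4] -/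
theorem packN_eq_sum (W : ℕ) : ∀ a : List ℕ, packN W a = ∑ i ∈ range a.length, a.getD i 0 * W ^ i
  | [] => by simp [packN]
  | x :: xs => by
      rw [packN, packN_eq_sum W xs, List.length_cons, Finset.sum_range_succ', Finset.mul_sum]
      simp only [List.getD_cons_succ, List.getD_cons_zero, pow_zero, mul_one, pow_succ]
      rw [add_comm]
      congr 1
      exact Finset.sum_congr rfl fun i _ ↦ by ring

/-- `packRevN` is the reversed evaluation `Σ_k b_k W^(n−1−k)`. [cite: GathenGerhard2013ModernComputerAlgebra, §8.4] -/
theorem packRevN_eq_sum (W : ℕ) : ∀ (n : ℕ) (b : List ℕ),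
    packRevN W n b = ∑ k ∈ range b.length, b.getD k 0 * W ^ (n - 1 - k)
  | n, [] => by simp [packRevN]
  | n, y :: ys => by
      rw [packRevN, packRevN_eq_sum W (n - 1) ys, List.length_cons, Finset.sum_range_succ']
      simp only [List.getD_cons_succ, List.getD_cons_zero, Nat.sub_zero]
      rw [add_comm]
      congr 1
      exact Finset.sum_congr rfl fun k _ ↦ by rw [show n - 1 - (k + 1) = n - 1 - 1 - k by omega]

/-- `sumN` as a `Finset` sum (radix bookkeeping). [cite: KnuthTAOCP2, §4.1] -/
theorem sumN_eq_sum : ∀ l : List ℕ, sumN l = ∑ i ∈ range l.length, l.getD i 0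
  | [] => by simp [sumN]
  | x :: xs => by
      rw [sumN, sumN_eq_sum xs, List.length_cons, Finset.sum_range_succ']
      simp only [List.getD_cons_succ, List.getD_cons_zero, add_comm]

/-- Entries beyond the list are `0`; entries inside obey the bound. [folklore] -/
private theorem getD_le_of_forall_le {M : ℕ} {l : List ℕ} (h : ∀ x ∈ l, x ≤ M) (i : ℕ) : l.getD i 0 ≤ M := by
  rw [List.getD_eq_getElem?_getD]
  by_cases hi : i < l.length
  · rw [List.getElem?_eq_getElem hi, Option.getD_some]; exact h _ (List.getElem_mem hi)
  · rw [List.getElem?_eq_none (not_lt.1 hi), Option.getD_none]; exact Nat.zero_le M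

/-! ## The product polynomial -/

/-- The `e`-th coefficient of `packN W a · packRevN W n b`: `Σ_{i,k : i + (n−1−k) = e} a_i b_k`.
[cite: GathenGerhard2013ModernComputerAlgebra, §8.4] -/
def coeff (n : ℕ) (a b : List ℕ) (e : ℕ) : ℕ :=
  ∑ i ∈ range a.length, ∑ k ∈ range b.length, if i + (n - 1 - k) = e then a.getD i 0 * b.getD k 0 else 0

/-- **The product is the packed coefficient sequence** (`2n − 1` coefficients).
[cite: GathenGerhard2013ModernComputerAlgebra, §8.4] -/
theorem packN_mul_packRevN {n : ℕ} (W : ℕ) {a b : List ℕ} (ha : a.length ≤ n) (hb : b.length ≤ n) :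
    packN W a * packRevN W n b = ∑ e ∈ range (2 * n - 1), coeff n a b e * W ^ e := by
  rw [packN_eq_sum, packRevN_eq_sum, Finset.sum_mul_sum]
  have rhs : ∑ e ∈ range (2 * n - 1), coeff n a b e * W ^ e
      = ∑ i ∈ range a.length, ∑ k ∈ range b.length,
          ∑ e ∈ range (2 * n - 1), (if i + (n - 1 - k) = e then a.getD i 0 * b.getD k 0 * W ^ e else 0) := by
    unfold coeff
    simp only [Finset.sum_mul]
    rw [Finset.sum_comm]
    refine Finset.sum_congr rfl fun i _ ↦ ?_
    rw [Finset.sum_comm]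
    refine Finset.sum_congr rfl fun k _ ↦ Finset.sum_congr rfl fun e _ ↦ ?_
    split_ifs <;> simp
  rw [rhs]
  refine Finset.sum_congr rfl fun i hi ↦ Finset.sum_congr rfl fun k hk ↦ ?_
  have hi' : i < n := lt_of_lt_of_le (Finset.mem_range.1 hi) ha
  have hk' : k < n := lt_of_lt_of_le (Finset.mem_range.1 hk) hb
  rw [Finset.sum_ite_eq (range (2 * n - 1)) (i + (n - 1 - k)) (fun e ↦ a.getD i 0 * b.getD k 0 * W ^ e),
    if_pos (Finset.mem_range.2 (by omega)), pow_add]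
  ring

/-- **The middle coefficient is the dot product** `Σ_{i<n} a_i b_i`. [cite: GathenGerhard2013ModernComputerAlgebra, §8.4] -/
theorem coeff_mid_eq_sum {n : ℕ} {a b : List ℕ} (ha : a.length ≤ n) (hb : b.length ≤ n) :
    coeff n a b (n - 1) = ∑ i ∈ range n, a.getD i 0 * b.getD i 0 := by
  unfold coeff
  have inner : ∀ i ∈ range a.length,
      (∑ k ∈ range b.length, if i + (n - 1 - k) = n - 1 then a.getD i 0 * b.getD k 0 else 0)
        = if i < b.length then a.getD i 0 * b.getD i 0 else 0 := by
    intro i hi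
    have e1 : ∀ k ∈ range b.length, (if i + (n - 1 - k) = n - 1 then a.getD i 0 * b.getD k 0 else 0)
        = (if i = k then a.getD i 0 * b.getD k 0 else 0) := by
      intro k hk
      have hk' : k < n := lt_of_lt_of_le (Finset.mem_range.1 hk) hb
      have hi' : i < n := lt_of_lt_of_le (Finset.mem_range.1 hi) ha
      have : (i + (n - 1 - k) = n - 1) ↔ (i = k) := by omega
      simp only [this]
    rw [Finset.sum_congr rfl e1, Finset.sum_ite_eq]
    simp only [Finset.mem_range]
  rw [Finset.sum_congr rfl inner]
  have lhs : ∑ i ∈ range a.length, (if i < b.length then a.getD i 0 * b.getD i 0 else 0)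
      = ∑ i ∈ range a.length, a.getD i 0 * b.getD i 0 := by
    refine Finset.sum_congr rfl fun i _ ↦ ?_
    split_ifs with h
    · rfl
    · rw [List.getD_eq_default b 0 (not_lt.1 h), mul_zero]
  rw [lhs]
  apply Finset.sum_subset (Finset.range_mono ha)
  intro i _ hi
  rw [Finset.mem_range, not_lt] at hi
  rw [List.getD_eq_default a 0 hi, zero_mul]

/-- **Coefficient bound** (the slot width condition of Kronecker substitution): `coeff e ≤ (#a)·Ma·Mb` (for each `i` at
most one `k` contributes). [cite: GathenGerhard2013ModernComputerAlgebra, §8.4] -/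
theorem coeff_le {n : ℕ} {a b : List ℕ} (hb : b.length ≤ n) {Ma Mb : ℕ}
    (hMa : ∀ x ∈ a, x ≤ Ma) (hMb : ∀ x ∈ b, x ≤ Mb) (e : ℕ) :
    coeff n a b e ≤ a.length * Ma * Mb := by
  unfold coeff
  have hone : ∀ i ∈ range a.length,
      ∑ k ∈ range b.length, (if i + (n - 1 - k) = e then a.getD i 0 * b.getD k 0 else 0) ≤ Ma * Mb := by
    intro i _
    have e1 : ∀ k ∈ range b.length, (if i + (n - 1 - k) = e then a.getD i 0 * b.getD k 0 else 0)
        = (if n - 1 + i - e = k then (if e ≤ n - 1 + i ∧ i ≤ e then a.getD i 0 * b.getD k 0 else 0) else 0) := by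
      intro k hk
      have hk' : k < n := lt_of_lt_of_le (Finset.mem_range.1 hk) hb
      by_cases h1 : i + (n - 1 - k) = e
      · rw [if_pos h1, if_pos (by omega), if_pos (by omega)]
      · rw [if_neg h1]
        by_cases h2 : n - 1 + i - e = k
        · rw [if_pos h2, if_neg (by omega)]
        · rw [if_neg h2]
    rw [Finset.sum_congr rfl e1, Finset.sum_ite_eq]
    split_ifs
    · exact Nat.mul_le_mul (getD_le_of_forall_le hMa _) (getD_le_of_forall_le hMb _)
    · exact Nat.zero_le _
    · exact Nat.zero_le _
  calc ∑ i ∈ range a.length, ∑ k ∈ range b.length,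
          (if i + (n - 1 - k) = e then a.getD i 0 * b.getD k 0 else 0)
      ≤ ∑ i ∈ range a.length, Ma * Mb := Finset.sum_le_sum hone
    _ = a.length * Ma * Mb := by rw [Finset.sum_const, Finset.card_range, smul_eq_mul, mul_assoc]

/-! ## Digits -/

/-- Positional representation: `Σ_{e<L} d_e W^e = Nat.ofDigits W [d₀, …, d_{L−1}]`. [cite: KnuthTAOCP2, §4.1] -/
theorem sum_eq_ofDigits (W : ℕ) (d : ℕ → ℕ) : ∀ L : ℕ,
    ∑ e ∈ range L, d e * W ^ e = Nat.ofDigits W ((List.range L).map d)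
  | 0 => by simp
  | L + 1 => by
      rw [Finset.sum_range_succ, sum_eq_ofDigits W d L, List.range_succ, List.map_append, Nat.ofDigits_append,
        List.map_singleton, Nat.ofDigits_singleton, List.length_map, List.length_range, mul_comm (d L)]

/-- **Base-`W` digit extraction**: digits `d_e < W` ⇒ `(Σ_{e<L} d_e W^e) / W^e₀ % W = d_{e₀}` (uniqueness of the
positional representation). [cite: KnuthTAOCP2, §4.1] -/
theorem sum_div_pow_mod {W : ℕ} (hW : 0 < W) (d : ℕ → ℕ) (hd : ∀ e, d e < W) {L e₀ : ℕ} (he : e₀ < L) :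
    (∑ e ∈ range L, d e * W ^ e) / W ^ e₀ % W = d e₀ := by
  rw [sum_eq_ofDigits, Nat.ofDigits_div_pow_eq_ofDigits_drop e₀ hW _
    (fun l hl ↦ by obtain ⟨e, -, rfl⟩ := List.mem_map.1 hl; exact hd e)]
  have hlt : e₀ < ((List.range L).map d).length := by simpa using he
  rw [List.drop_eq_getElem_cons hlt, Nat.ofDigits_cons, List.getElem_map, List.getElem_range,
    Nat.add_mul_mod_self_left, Nat.mod_eq_of_lt (hd e₀)]

/-! ## The theorem -/

/-- **Kronecker substitution computes the dot product.**  For `a`, `b : List ℕ` of lengths `≤ n` (`1 ≤ n`) with entries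
`≤ Ma`, `≤ Mb` and slot base `W` with `n·Ma·Mb < W`:
`kdotN W n (packN W a) (packRevN W n b) = Σ_{i<n} a_i b_i` (zero-padded). [cite: GathenGerhard2013ModernComputerAlgebra, §8.4] -/
theorem kdotN_packN_packRevN {W n : ℕ} (hn : 1 ≤ n) {a b : List ℕ} (ha : a.length ≤ n) (hb : b.length ≤ n)
    {Ma Mb : ℕ} (hMa : ∀ x ∈ a, x ≤ Ma) (hMb : ∀ x ∈ b, x ≤ Mb) (hcap : n * Ma * Mb < W) :
    kdotN W n (packN W a) (packRevN W n b) = ∑ i ∈ range n, a.getD i 0 * b.getD i 0 := by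
  have hW : 0 < W := lt_of_le_of_lt (Nat.zero_le _) hcap
  have hcb : ∀ e, coeff n a b e < W := fun e ↦ by
    refine lt_of_le_of_lt ((coeff_le hb hMa hMb e).trans ?_) hcap
    exact Nat.mul_le_mul_right _ (Nat.mul_le_mul_right _ ha)
  unfold kdotN
  rw [packN_mul_packRevN W ha hb, sum_div_pow_mod hW (coeff n a b) hcb (by omega : n - 1 < 2 * n - 1),
    coeff_mid_eq_sum ha hb]

end KroneckerDot

end Literature.Analysis.ValidatedNumerics
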